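/-
Copyright (c) 2026. All rights reserved.
Released under Apache 2.0 license as described in the file LICENSE.
Authors: abc-iut cell, wave-2 seat abc-iut-L3-t11 (proof-only companion of abc-iut-L4-t3's
`LogShellVolumes.lean`, Cor 5.10 (ii) at the real logarithms).
-/
import Literature.AnabelianGeometry.AbsoluteAnabelian.LogShellVolumes
import Literature.AnabelianGeometry.AbsoluteAnabelian.LogIsometricUnitLog
import Literature.AnabelianGeometry.AbsoluteAnabelian.LocalVolumesNonarchimedeanProofs
import Literature.AnabelianGeometry.AbsoluteAnabelian.LocalVolumesArchimedeanProofs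
import HarnessLib

/-!
# [AbsTopIII] Corollary 5.10 (ii) at the REAL logarithms: log-Frobenius compatibility of log-volumes

S. Mochizuki, *Topics in absolute anabelian geometry III*, J. Math. Sci. Univ. Tokyo 22 (2015)
[MochizukiAbsTopIII2015], Cor 5.10 (ii) (Log-Frobenius Compatibility of Log-volumes), manuscript p. 147:
"the log-volume (resp. radial log-volume) computed at `⋎ ∈ L` is compatible [cf. Prop 5.7 (i)(c), (ii)(c)],
relative to the relevant log-homotopy, with the log-volume (resp. angular log-volume) computed at `⋎ + 1 ∈ L`".

Seat abc-iut-L4-t3 typed this (`LogShellVolumes.lean`, p404735) as the predicate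
`LogVolumesLogCompatible K log hasArc` on a FAMILY of local logarithms `log v : K v → K v` over the
nonarchimedean places and the exponential of `ℂ` at the archimedean ones:
`(∀ v, LogVolumeCompatible (log v)) ∧ (hasArc → ComplexVolume.ExpLogVolumeCompatible)`.
This PROOF-ONLY companion DISCHARGES it at the REAL logarithms — `log v := unitLog` = abc-iut-S1's `p_v`-adic
logarithm on `𝒪_{K_v}^×` (`Literature.IUT.LogVolume.LocalUnitLog`), each `K v` a mixed-characteristic local field
of residue characteristic `p v` in the norm-side description — unconditionally:

* nonarchimedean conjunct = [AbsTopIII] Prop 5.7 (i)(c) for `unitLog`: abc-iut-L4-t8's combinatorial half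
  `LogVolumeCompatibleOfIsometric_holds` (`LocalVolumesNonarchimedeanProofs.lean`) applied to the analytic half
  `isIsometricOnSmallBalls_unitLog` via `logVolumeCompatible_unitLog_of` (`LogIsometricUnitLog.lean`, p405130)
  — the same term as abc-iut-L4-t8's `logVolumeCompatible_unitLog`;
* archimedean conjunct = [AbsTopIII] Prop 5.7 (ii)(c), abc-iut-L4-t8's `ComplexVolume.ExpLogVolumeCompatible_holds`
  (`LocalVolumesArchimedeanProofs.lean`).

No definitions; classical local-field content; nothing here bears on anything disputed.
-/

set_option autoImplicit false

noncomputable section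

namespace Literature.AnabelianGeometry.AbsoluteAnabelian

open Literature.IUT.LogVolume

/-- **[AbsTopIII] Cor 5.10 (ii) (Log-Frobenius Compatibility of Log-volumes), DISCHARGED at the real
logarithms**: for a family `K v` (`v ∈ V^non`) of mixed-characteristic local fields of residue characteristics
`p v`, the family of abc-iut-S1's `p_v`-adic logarithms `unitLog : K v → K v` together with the complex
exponential satisfies abc-iut-L4-t3's `LogVolumesLogCompatible` — every nonarchimedean log-volume is compatible
with `log_v` (Prop 5.7 (i)(c)) and the radial/angular log-volumes are compatible with `exp` (Prop 5.7 (ii)(c)).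
[cite: MochizukiAbsTopIII2015, Cor 5.10 (ii) p. 147] -/
theorem logVolumesLogCompatible_unitLog {Vnon : Type} (p : Vnon → ℕ) [∀ v, Fact (p v).Prime]
    (K : Vnon → Type) [∀ v, NontriviallyNormedField (K v)] [∀ v, NormedAlgebra ℚ_[p v] (K v)]
    [∀ v, IsUltrametricDist (K v)] [∀ v, ProperSpace (K v)] [∀ v, MeasurableSpace (K v)]
    [∀ v, BorelSpace (K v)] (hasArc : Prop) :
    LogVolumesLogCompatible K (fun v => (unitLog : K v → K v)) hasArc :=
  ⟨fun v => logVolumeCompatible_unitLog_of (p v) (LogVolumeCompatibleOfIsometric_holds (K := K v)),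
    fun _ => ComplexVolume.ExpLogVolumeCompatible_holds⟩

end Literature.AnabelianGeometry.AbsoluteAnabelian

end
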